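import Literature.MathematicalPhysics.QuantumFieldTheory.Balaban1983to89.B6CubeWindowV1
import Literature.MathematicalPhysics.QuantumFieldTheory.Balaban1983to89.B6MemberLevelsWindow
import HarnessLib

/-!
# [B6] Prop. 2.6, (2.92) LINE 3: THE MEMBER DATA OF THE CUBE MEMBER `t(□)` FOR `line3_window_member` — `hN₁`, `hsat`, `hal`, `hlevW` discharged for
r03's `B6CubeWindowV1.tC` with the p21 member family `famOf (M_h/L) j₀ P₁ R₁ … Λ′(□)`

statement-level skeleton of published theorems with citation tags; proofs where landed; nothing here is a claim about the Yang–Mills mass gap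

[tag: formalized_from_source] (bookkeeping ours; print p. 238 *"we take the cube □̃³ and identify it with a torus"*, (2.89)–(2.90) p. 239
[cite: Balaban1984PropagatorsII, (2.89)–(2.90) p.239, p.238].)

## What

`member_data_tC`: for a placed cube `□ = c` of the `k`-level V1 torus (`M_h = L^a`, `a ≥ 1`, `k ≥ 2`, `R ≥ 2L²`), the member `t := tC hN hk hMh1 hP4 c ha a wc cf`
(`B6CubeWindowV1`; chart frame `D.chart (svec ℓ k c.1.1 c.1.2)`, corner `x0 ℓ Mh k c.1`, scale `j₀ = j0 hMh1 hP4 c`) and the member block family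
`D_□ := famOf (L^{a−1}) j₀ (fun _ => 2L^{j−j₀+1}) R₁ (one_le_j0 …) t.Λ′` (`B6MemberTorusTDomainsV1`) satisfy the four member-side hypotheses of
`B6Line3WindowV1.line3_window_member`: the box equation `hN₁`, the big-block saturation `hsat`, the corner alignment `hal`, and the level agreement
`hlevW` through the window — each by ONE landed lemma (`N0_member`, `lam_tOf_sat`, `dvd_of_dvdB`, `lev_famOf_tOf` with `hlev_deep`).

No measure, no Yang–Mills claim.
-/

open scoped BigOperators
open Finset

namespace Literature.MathematicalPhysics.QuantumFieldTheory.Balaban1983to89.B6Line3MemberDataV1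

open B4Reflection242 (boxDom)
open B6MultiLevelBoxOperator (N0 bigSide)
open B6MultiLevelTorusOperator (TDomains)
open B6Eq238MultiLevelTorus (svec)
open B6Cover236MultiLevelBlocks (cubes)
open B6GlobalChartV1 (PV toBox domT)
open B6AgreeLapV1Chart (eS DeepS)
open B6SectAOperatorsV1 (BondIdx)
open B6CubeWindowV1 (tC x0 eC j0 j0_hj j0_le_level one_le_j0 hx0 hfit hlev_deep Placed bigSide_dvd_x0)
open B6MemberTorusTDomainsV1 (famOf bigLab N0_member)
open B6MemberLevelsWindow (lam_tOf_sat lev_famOf_tOf)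

variable {d ℓ m K : ℕ} {hd : 1 ≤ d + 1} {hL : Odd (ℓ + 1) ∧ 1 < ℓ + 1} {a₀ a₁ : ℝ} {Mh k R : ℕ} {P' : Fin (d + 1) → ℕ}

/-- **THE MEMBER-SIDE BINDERS OF `B6Line3WindowV1.line3_window_member` FOR THE CUBE MEMBER `t(□) = tC …`** (chart frame `D.chart s_□`),
with `M′ := L^{a−1}` (`M_h = L^a`), member period `P₁ ≡ 2L^{j−j₀+1}` (`j` = level of the cube, `j₀ = j0 …`), any `R₁`:
(1) `hN₁` — the member box IS the member torus `T^{(0)}` of size `2L^{a+j+2}` (`B6MemberTorusTDomainsV1.N0_member`);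
(2) `hsat` — `Λ′(□)` is saturated by the member big blocks (`B6MemberLevelsWindow.lam_tOf_sat`);
(3) `hal` — `L^{j₀+1} ∣ x₀(□)` (the quarter-point corner is a multiple of `S_j = M_hL^{j+1}`);
(4) `hlevW` — the levels of `D_□ := famOf M′ j₀ P₁ R₁ … Λ′(□)` agree with the global levels through the window (`lev_famOf_tOf` + r03's
`B6CubeWindowV1.hlev_deep`). Hypotheses: `Placed`, `R ≥ 2L²`, `k ≥ 2`, `a ≥ 1`.
[cite: Balaban1984PropagatorsII, (2.89)–(2.90) p.239, p.238 («we take the cube □̃³ and identify it with a torus»), (2.1)–(2.2) p.224; derivation ours] -/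
theorem member_data_tC
    (hN : ∀ μ, N0 ℓ Mh k P' μ = (PV d ℓ m K hd hL).sitesPerDir 0) {D : TDomains d ℓ Mh k P' R} (hk : k ≤ m + K)
    (hMh1 : 1 ≤ Mh) (hP4 : ∀ μ, 4 ≤ P' μ) {a : ℕ} (hMha : Mh = (ℓ + 1) ^ a) (c : ↥(cubes D.toDomains)) (ha : a₀ ≤ a₁)
    (hpl : Placed ℓ k P' c.1) (hR2 : 2 * (ℓ + 1) ^ 2 ≤ R) (hk2 : 2 ≤ k) (ha1 : 1 ≤ a)
    (wc : BondIdx (domT hN (D.chart (svec ℓ k c.1.1 c.1.2)) hk) → ℝ) (cf : ℝ) {R₁ : ℕ} :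
    (∀ μ : Fin (d + 1), N0 ℓ ((ℓ + 1) ^ (a - 1)) (j0 hMh1 hP4 c + 1) (fun _ => 2 * (ℓ + 1) ^ (c.1.1 - j0 hMh1 hP4 c + 1)) μ =
        (PV d ℓ (eC a c.1.1) 0 hd hL).sitesPerDir 0) ∧
    (∀ Y Y' : Site (PV d ℓ (eC a c.1.1) 0 hd hL) (j0 hMh1 hP4 c + 1),
        bigLab ((ℓ + 1) ^ (a - 1)) Y = bigLab ((ℓ + 1) ^ (a - 1)) Y' →
          (Y ∈ (tC hN hk hMh1 hP4 c ha a wc cf).Λ' ↔ Y' ∈ (tC hN hk hMh1 hP4 c ha a wc cf).Λ')) ∧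
    (∀ μ, ((((ℓ + 1) ^ (j0 hMh1 hP4 c + 1) : ℕ) : ℤ)) ∣ x0 ℓ Mh k c.1 μ) ∧
    (∀ (hN₁ : ∀ μ : Fin (d + 1), N0 ℓ ((ℓ + 1) ^ (a - 1)) (j0 hMh1 hP4 c + 1) (fun _ => 2 * (ℓ + 1) ^ (c.1.1 - j0 hMh1 hP4 c + 1)) μ =
        (PV d ℓ (eC a c.1.1) 0 hd hL).sitesPerDir 0),
      ∀ x ∈ DeepS (tC hN hk hMh1 hP4 c ha a wc cf) (x0 ℓ Mh k c.1) 0,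
        (famOf ((ℓ + 1) ^ (a - 1)) (j0 hMh1 hP4 c) (fun _ => 2 * (ℓ + 1) ^ (c.1.1 - j0 hMh1 hP4 c + 1)) R₁ (one_le_j0 hMh1 hP4 c hk2)
            (tC hN hk hMh1 hP4 c ha a wc cf).Λ').lev (toBox hN₁ (eS (tC hN hk hMh1 hP4 c ha a wc cf) (x0 ℓ Mh k c.1) x) : Fin (d + 1) → ℤ) =
          (D.chart (svec ℓ k c.1.1 c.1.2)).lev (toBox hN x)) := by
  have hj0 := (j0_le_level hMh1 hP4 c hL hR2).1
  have hj1 : 1 ≤ j0 hMh1 hP4 c := one_le_j0 hMh1 hP4 c hk2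
  have hjk : j0 hMh1 hP4 c + 1 ≤ k := by unfold j0; omega
  have hM1 : 1 ≤ (ℓ + 1) ^ (a - 1) := Nat.one_le_pow _ _ (by omega)
  have hMhdvd : (ℓ + 1) ^ (a - 1) ∣ Mh := by
    rw [hMha]; exact Nat.pow_dvd_pow _ (by omega)
  have hdivB : ∀ μ, ((((ℓ + 1) ^ (j0 hMh1 hP4 c + 1) * ((ℓ + 1) ^ (a - 1) * (ℓ + 1)) : ℕ) : ℤ)) ∣ x0 ℓ Mh k c.1 μ := by
    intro μ
    refine dvd_trans ?_ (bigSide_dvd_x0 ℓ Mh k c.1 μ)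
    have h1 : (ℓ + 1) ^ (a - 1) * (ℓ + 1) ∣ Mh := ⟨1, by rw [mul_one, hMha, ← pow_succ, Nat.sub_add_cancel ha1]⟩
    have h2 : (ℓ + 1) ^ (j0 hMh1 hP4 c + 1) ∣ (ℓ + 1) ^ (c.1.1 + 1) := Nat.pow_dvd_pow _ (by omega)
    have h3 : (ℓ + 1) ^ (j0 hMh1 hP4 c + 1) * ((ℓ + 1) ^ (a - 1) * (ℓ + 1)) ∣ bigSide ℓ Mh c.1.1 := by
      unfold bigSide; rw [mul_comm Mh]; exact Nat.mul_dvd_mul h2 h1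
    exact Int.natCast_dvd_natCast.2 h3
  refine ⟨fun μ => N0_member ℓ (j0 hMh1 hP4 c) (a - 1) (c.1.1 - j0 hMh1 hP4 c + 1) (eC a c.1.1) 0 hd hL ?_ μ, ?_, ?_, ?_⟩
  · unfold eC; omega
  · intro Y Y' h
    exact lam_tOf_sat hjk (hx0 hpl) (hfit hN hMh1 hP4 hMha c ha hpl) hdivB hMhdvd hM1 hj1 Y Y' h
  · intro μ
    exact B6MemberLevelsWindow.dvd_of_dvdB hdivB μ
  · intro hN₁ x hx
    exact lev_famOf_tOf hjk (hx0 hpl) (hfit hN hMh1 hP4 hMha c ha hpl) hdivB hMhdvd hM1 hj1 hN₁ (hlev_deep hN hMh1 hP4 hMha c ha hR2) hx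

end Literature.MathematicalPhysics.QuantumFieldTheory.Balaban1983to89.B6Line3MemberDataV1
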